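import Summits.CriticalPhenomena.PercolationContinuityZ3.Theorems.Transplant.FKConnectivityAllQForestNodeScpDuality
import HarnessLib

/-!
# The DETOUR LEMMA node (NOT asserted) and its first consequence: the weighted triangle inequality
# behind the two-cell bound H1′ at a vertex adjacent to both ends `v, y` (the "D-rule", kvy = 2 class)

Support file (`--supports stmt-CriticalPhenomena-4575`), FK sub-lane `prim-bschramm-fk-1` (generation 31) of the post-continuity
programme; builds on p205010 (kernel theorem, internal audit signed; external expert review pending).  One counting node (NOT asserted),
theorems otherwise; no named facts, no sorries; standard axioms.

SETTING.  Ordered two-forest colourings `(ω, ω ∆ M)` of a fibre `(M, u₀)` (first class `ω ⊇ u₀`, second class `ω ∆ M ⊇ u₀`, both forests),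
as everywhere in this directory (`fibreCount`).

**THE DETOUR LEMMA `DetourOn V` (DL, conjecture-shaped, NOT asserted).**  For a pair `e = ov` and ANY vertex `w`: among the colourings with
`e` in the first class and `o ~ v` in the SECOND class (so the second class holds a detour `o ⇝ v` avoiding `e`), the second class joins `o`
to `w` at least as often as the first class does; stated in the equivalent avoidance form
`#(Fo ∩ {e ∈ ω}, Fo ∩ {o ~ v} ∩ {o ≁ w}) ≤ #(Fo ∩ {e ∈ ω} ∩ {o ≁ w}, Fo ∩ {o ~ v})`.
In words: *the class carrying the detour has the (weakly) larger cluster at `o`, vertex by vertex*.  It implies g25's same-class preference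
SCP (`ForestSameClassPrefOn`, `…ForestNodeScpDuality`) and is strictly stronger.  EVIDENCE (exact, exhaustive, isomorph-free; engine
numerics31/ucensus.c of the seat, validated against an independent enumerator on 13,000 cells): every connected simple graph with n ≤ 9 vertices,
every pair `e`, every `w` (n = 9: 11,761,246 instances, 6,414,316 tight; n = 8: 691,236) and every multigraph with multiplicities ≤ 2 on ≤ 8 vertices
(20,928,720 instances): 0 failures; the set form "the second-class cluster of `o` HITS every vertex set at least as often" also 0 failures, while
the set form "CONTAINS a vertex set" is FALSE (120 failures at n = 9, `K₄ − vy` plus a `K_{2,k}` bundle).  Kit census n = 10 / multigraph n = 9: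
memo bschramm/FROM-fk-1-g31-DETOUR.md.

**THE CONSEQUENCE (next file `…ForestDetourTriangle`, `forest_triangle_weighted_of_detour`; this file supplies the transport `detour_transfer`).**  On a fibre through the triangle `e = ov, f = oy, t = vy` (all free) and
for every vertex `w`, the colourings with `e` in the first class split by the apex of the two triangle pairs lying in one class:
`(o,A)`: `e,f ∈ ω` (then `t ∈ ω ∆ M`);  `(v,A)`: `e,t ∈ ω`, `f ∈ ω ∆ M`;  `(y,B)`: `e ∈ ω`, `f,t ∈ ω ∆ M`.  DL implies
`#(o,A) + #((o,A) ∩ {w ≁ v in ω ∆ M}) ≤ #(v,A) + #((v,A) ∩ {w ≁ o in ω}) + #(y,B) + #((y,B) ∩ {w ≁ o in ω ∆ M})`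
— the WEIGHTED TRIANGLE INEQUALITY (WT of memo bschramm/FROM-fk-1-g30-LAMAN-IDENTITIES.md §4/§6), which is EXACTLY the two-cell bound H1′
(`TwoCellIneq` of `…ForestTwoCellBound`) at a vertex `z` with free pairs `zv, zy, zw` for the dominating pair `vy` (file
`…ForestTwoCellDetour`: the translation to the rest fibre).  PROOF: the triangle theorem's exchanges `f ↔ t` (defined when `o ≁ y` in
`(ω ∆ M) ∖ t`) and `e ↔ t` (when `o ≁ v` there) preserve the vertex partition of the first class, so they carry the event `{w ≁ o in ω}` along;
both are defined exactly when `o ≁ v` in `ω ∆ M`, which pays for the weight 2; on `{o ~ v in ω ∆ M}` the missing weight is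
`#((o,A) ∩ {o ~ v, w ≁ o in ω ∆ M}) ≤ #((o,A) ∩ {w ≁ o in ω} ∩ {o ~ v in ω ∆ M})`, which is DL on the fibre `(M ∖ {f,t}, u₀ ∪ {t})`
transported by `ω ↦ (ω ∖ {f}) ∪ {t}` (**`detour_transfer`**).
[cite: CibulkaHladkyLaCroixWagner2008, Thm. 1 (p. 2), Case 3, Table 1 (p. 5)] [cite: SempleWelsh2008, Conj. 1.1 (p. 2); Thm. 4.2 (p. 11)]
[cite: Linusson2011, Prop. 2.6] [cite: Grimmett2006, §1.5 (p. 13)]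
-/

noncomputable section

namespace Summit.CriticalPhenomena.PercolationContinuityZ3.Theorems
namespace FK

open Set Literature.Probability.LatticeModels Literature.Probability.Percolation
open BHK2006 (openGraph_le)
open scoped Classical symmDiff

variable {V : Type*} [Fintype V]

/-! ### The node -/

/-- **THE DETOUR LEMMA on the vertex type `V`** (conjecture-shaped, NOT asserted): for every fibre `(M, u₀)`, every pair `ov` and every
vertex `w`, `#(Fo ∩ {ov ∈ ω}, Fo ∩ {o ~ v} ∩ {o ≁ w}) ≤ #(Fo ∩ {ov ∈ ω} ∩ {o ≁ w}, Fo ∩ {o ~ v})` — among the colourings whose first class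
holds `ov` and whose second class joins `o` to `v` by a detour, `w` avoids the cluster of `o` in the second class at most as often as in the first.
[cite: SempleWelsh2008, Conj. 1.1 (p. 2)] [cite: Linusson2011, Prop. 2.6] -/
def DetourOn (V : Type*) [Fintype V] : Prop :=
  ∀ (M u₀ : BondConfig V), Disjoint u₀ M → ∀ (o v w : V),
    fibreCount M u₀ (forestEv V ∩ {ω | s(o, v) ∈ ω}) (forestEv V ∩ reachEv o v ∩ (reachEv o w)ᶜ) ≤
      fibreCount M u₀ (forestEv V ∩ {ω | s(o, v) ∈ ω} ∩ (reachEv o w)ᶜ) (forestEv V ∩ reachEv o v)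

/-- **The detour lemma on every finite vertex type.**  CONJECTURE-SHAPED, NOT asserted (evidence in the module docstring).
[cite: SempleWelsh2008, Conj. 1.1 (p. 2); Thm. 4.2 (p. 11)] -/
@[conjecture] def DetourPos : Prop := ∀ n : ℕ, DetourOn (Fin n)

/-! ### Reachability and set tools -/

section Tools

variable {ω X M u₀ : BondConfig V} {o v y w x : V}

omit [Fintype V] in
/-- Inserting a pair whose ends are ALREADY joined in a larger configuration creates no new connections there. [folklore] -/
theorem reachable_of_reachable_insert_of_subset {p q z z' : V} (hX : X ⊆ ω) (hpq : (openGraph ω).Reachable p q)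
    (h : (openGraph (insert s(p, q) X)).Reachable z z') : (openGraph ω).Reachable z z' := by
  have h1 : (openGraph (insert s(p, q) ω)).Reachable z z' := h.mono (openGraph_le (insert_subset_insert hX))
  rcases reachable_insert_or_detour ω p q h1 with h2 | ⟨h2, h3⟩
  · exact h2
  · have hz : (openGraph ω).Reachable z p := by
      rcases h2 with h2 | h2
      · exact h2
      · exact h2.trans hpq.symm
    rcases h3 with h3 | h3
    · exact hz.trans h3
    · exact (hz.trans hpq).trans h3

omit [Fintype V] in
/-- In a configuration through `ov` and `oy`, exchanging any pair for `vy` creates no new connections. [folklore] -/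
theorem reachable_of_reachable_exchange (hov : o ≠ v) (hoy : o ≠ y) (he : s(o, v) ∈ ω) (hf : s(o, y) ∈ ω) {a : Sym2 V}
    (h : (openGraph (insert s(v, y) (ω \ {a}))).Reachable x w) : (openGraph ω).Reachable x w := by
  have hvo : (openGraph ω).Reachable v o := ((openGraph_adj _ _ _).2 ⟨Sym2.eq_swap ▸ he, hov.symm⟩).reachable
  have hoy' : (openGraph ω).Reachable o y := ((openGraph_adj _ _ _).2 ⟨hf, hoy⟩).reachable
  exact reachable_of_reachable_insert_of_subset sdiff_subset (hvo.trans hoy') h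

omit [Fintype V] in
/-- The transport `ω ↦ (ω ∖ {f}) ∪ {t}` lands in the fibre `(M ∖ {f,t}, u₀ ∪ {t})`. [folklore] -/
theorem insert_sdiff_sdiff_sdiff_pair {f t : Sym2 V} (hω : ω \ M = u₀) (hfM : f ∈ M) (htω : t ∉ ω) :
    insert t (ω \ {f}) \ (M \ {f, t}) = insert t u₀ := by
  subst hω
  ext x
  simp only [mem_sdiff, mem_insert_iff, mem_singleton_iff]
  by_cases hxt : x = t
  · subst hxt; tauto
  · by_cases hxf : x = f
    · subst hxf; tauto
    · tauto

omit [Fintype V] in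
/-- The transport keeps the partner: `((ω ∖ {f}) ∪ {t}) ∆ (M ∖ {f,t}) = ω ∆ M` (`f ∈ ω ∩ M`, `t ∈ M ∖ ω`). [folklore] -/
theorem insert_sdiff_symmDiff_sdiff_pair {f t : Sym2 V} (hfM : f ∈ M) (htM : t ∈ M) (hfω : f ∈ ω) (htω : t ∉ ω) :
    insert t (ω \ {f}) ∆ (M \ {f, t}) = ω ∆ M := by
  ext x
  simp only [Set.mem_symmDiff, mem_sdiff, mem_insert_iff, mem_singleton_iff]
  by_cases hxt : x = t
  · subst hxt; tauto
  · by_cases hxf : x = f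
    · subst hxf; tauto
    · tauto

omit [Fintype V] in
/-- The inverse transport `ω' ↦ (ω' ∖ {t}) ∪ {f}` lands back in the fibre `(M, u₀)`. [folklore] -/
theorem insert_sdiff_sdiff_of_pair {ω' : BondConfig V} {f t : Sym2 V} (hω' : ω' \ (M \ {f, t}) = insert t u₀) (hfM : f ∈ M)
    (hfω' : f ∉ ω') (htu : t ∉ u₀) (hft : f ≠ t) :
    insert f (ω' \ {t}) \ M = u₀ := by
  ext x
  have hx := Set.ext_iff.1 hω' x
  simp only [mem_sdiff, mem_insert_iff, mem_singleton_iff] at hx ⊢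
  by_cases hxt : x = t
  · subst hxt; tauto
  · by_cases hxf : x = f
    · subst hxf; tauto
    · tauto

end Tools

/-! ### The exchanges of the triangle theorem, carrying a first-class event -/

section Exchange

variable {M u₀ : BondConfig V} {o v y : V}

/-- **The exchange `a ↔ vy` carrying an event** (cf. `fibreCount_exchange_le` of `…ForestAdjacentTriangle`): for `a = s(o, p) ∈ M`, `b ≠ a`,
`g = s(v, y) ∈ M`, the map `ω ↦ (ω ∖ {a}) ∪ {g}` injects the fibre pairs with `a, b ∈ ω ∈ Fo ∩ X`, `ω ∆ M ∈ Fo`, `g ∉ ω`, `v ↮ y` in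
`ω ∖ {a}`, `o ↮ p` in `(ω ∆ M) ∖ {g}` into the pairs with `b, g ∈ ω' ∈ Fo ∩ X'`, `a ∈ ω' ∆ M ∈ Fo`, provided the map carries `X` into `X'`.
[cite: Linusson2011, Prop. 2.6] [cite: Grimmett2006, §1.5 (p. 13)] -/
theorem fibreCount_exchange_le_event {a b : Sym2 V} {p : V} (ha : a = s(o, p)) (hop : o ≠ p) (hvy : v ≠ y)
    (haM : a ∈ M) (hgM : s(v, y) ∈ M) (hab : a ≠ b) (X X' : Set (BondConfig V))
    (hX : ∀ ω : BondConfig V, a ∈ ω → b ∈ ω → ω ∈ X → insert s(v, y) (ω \ {a}) ∈ X') :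
    fibreCount M u₀ (forestEv V ∩ {ω | a ∈ ω ∧ b ∈ ω} ∩ {ω | s(v, y) ∉ ω ∧ ¬ (openGraph (ω \ {a})).Reachable v y ∧
        ¬ (openGraph ((ω ∆ M) \ {s(v, y)})).Reachable o p} ∩ X) (forestEv V) ≤
      fibreCount M u₀ (forestEv V ∩ {ω | b ∈ ω} ∩ {ω | s(v, y) ∈ ω} ∩ X') (forestEv V ∩ {ω | a ∈ ω}) := by
  subst ha
  refine fibreCount_le_of_injOn (fun ω => insert s(v, y) (ω \ {s(o, p)})) (fun ω hω hA hB => ?_)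
    (fun ω ω' hω hA hB hω' hA' hB' h => ?_)
  · obtain ⟨⟨⟨hF, haω, hbω⟩, hgω, hvy', hop'⟩, hXω⟩ := hA
    have hga : s(v, y) ∉ ω \ {s(o, p)} := fun h' => hgω h'.1
    have haB : s(o, p) ∉ (ω ∆ M) \ {s(v, y)} := fun h' => by
      have := h'.1; rw [Set.mem_symmDiff] at this
      rcases this with ⟨-, h''⟩ | ⟨-, h''⟩
      · exact h'' haM
      · exact h'' haω
    refine ⟨by rw [insert_sdiff_singleton_sdiff haM hgM, hω], ⟨⟨⟨?_, ?_⟩, mem_insert _ _⟩, hX ω haω hbω hXω⟩, ?_⟩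
    · exact (isForestCfg_insert_iff hvy hga).2 ⟨isForestCfg_of_subset hF sdiff_subset, hvy'⟩
    · exact mem_insert_of_mem _ ⟨hbω, fun h' => hab (mem_singleton_iff.1 h').symm⟩
    · rw [insert_sdiff_singleton_symmDiff haM hgM haω hgω]
      refine ⟨?_, mem_insert _ _⟩
      exact (isForestCfg_insert_iff hop haB).2 ⟨isForestCfg_of_subset hB sdiff_subset, hop'⟩
  · have h1 : insert s(o, p) (insert s(v, y) (ω \ {s(o, p)}) \ {s(v, y)}) = ω :=
      insert_sdiff_insert_sdiff_cancel hA.1.1.2.1 hA.1.2.1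
    have h2 : insert s(o, p) (insert s(v, y) (ω' \ {s(o, p)}) \ {s(v, y)}) = ω' :=
      insert_sdiff_insert_sdiff_cancel hA'.1.1.2.1 hA'.1.2.1
    rw [← h1, ← h2, h]

end Exchange

/-! ### Transporting the detour lemma onto the triangle fibre -/

section Transfer

variable {M u₀ : BondConfig V} {o v y : V}

/-- **DL transported to the triangle fibre** (`e = ov, f = oy, t = vy ∈ M`, `o, v, y` distinct): under `DetourOn V`, among the colourings with
`e, f` in the first class and `o ~ v` in the second class, `w` avoids the cluster of `o` in the second class at most as often as in the first
— by moving `ω ↦ (ω ∖ {f}) ∪ {t}` into the fibre `(M ∖ {f,t}, u₀ ∪ {t})` (the partner is unchanged), applying `DetourOn`, and moving back.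
[cite: Linusson2011, Prop. 2.6] [cite: Grimmett2006, §1.5 (p. 13)] -/
theorem detour_transfer (hD : DetourOn V) (hd : Disjoint u₀ M) (hov : o ≠ v) (hoy : o ≠ y) (hvy : v ≠ y)
    (hfM : s(o, y) ∈ M) (htM : s(v, y) ∈ M) (w : V) :
    fibreCount M u₀ (forestEv V ∩ {ω | s(o, v) ∈ ω ∧ s(o, y) ∈ ω}) (forestEv V ∩ reachEv o v ∩ (reachEv o w)ᶜ) ≤
      fibreCount M u₀ (forestEv V ∩ {ω | s(o, v) ∈ ω ∧ s(o, y) ∈ ω} ∩ (reachEv o w)ᶜ) (forestEv V ∩ reachEv o v) := by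
  have hef : s(o, v) ≠ s(o, y) := fun h' => hvy (Sym2.congr_right.1 h')
  have het : s(o, v) ≠ s(v, y) := fun h' => by
    rcases Sym2.eq_iff.1 h' with ⟨h1, -⟩ | ⟨h1, -⟩
    exacts [hov h1, hoy h1]
  have hft : s(o, y) ≠ s(v, y) := fun h' => hov (Sym2.congr_left.1 h')
  have hfu : s(o, y) ∉ u₀ := fun h' => Set.disjoint_left.1 hd h' hfM
  have htu : s(v, y) ∉ u₀ := fun h' => Set.disjoint_left.1 hd h' htM
  set M'' : BondConfig V := M \ {s(o, y), s(v, y)} with hM''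
  set u'' : BondConfig V := insert s(v, y) u₀ with hu''
  have hd'' : Disjoint u'' M'' := by
    rw [hu'', Set.disjoint_insert_left]
    exact ⟨fun h' => h'.2 (Or.inr rfl), Disjoint.mono_right sdiff_subset hd⟩
  -- facts about a source colouring
  have src : ∀ ω : BondConfig V, ω \ M = u₀ → ω ∈ forestEv V ∩ {ω | s(o, v) ∈ ω ∧ s(o, y) ∈ ω} →
      s(v, y) ∉ ω ∧ IsForestCfg (insert s(v, y) (ω \ {s(o, y)})) := by
    rintro ω hω ⟨hF, he, hf⟩
    have ht : s(v, y) ∉ ω := not_mem_of_isForestCfg_of_two_mem hov hoy hvy hF he hf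
    refine ⟨ht, (isForestCfg_insert_iff hvy fun h' => ht h'.1).2
      ⟨isForestCfg_of_subset hF sdiff_subset, not_reachable_sdiff_of_two_mem hov hoy hvy hF he hf⟩⟩
  -- step (i): move into the fibre `(M'', u'')`
  have step1 : fibreCount M u₀ (forestEv V ∩ {ω | s(o, v) ∈ ω ∧ s(o, y) ∈ ω}) (forestEv V ∩ reachEv o v ∩ (reachEv o w)ᶜ) ≤
      fibreCount M'' u'' (forestEv V ∩ {ω | s(o, v) ∈ ω}) (forestEv V ∩ reachEv o v ∩ (reachEv o w)ᶜ) := by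
    refine fibreCount_le_of_injOn (fun ω => insert s(v, y) (ω \ {s(o, y)})) (fun ω hω hA hB => ?_)
      (fun ω ω' hω hA hB hω' hA' hB' h => ?_)
    · obtain ⟨ht, hF'⟩ := src ω hω hA
      refine ⟨insert_sdiff_sdiff_sdiff_pair hω hfM ht, ⟨hF', mem_insert_of_mem _ ⟨hA.2.1, fun h' => hef (mem_singleton_iff.1 h')⟩⟩, ?_⟩
      rw [insert_sdiff_symmDiff_sdiff_pair hfM htM hA.2.2 ht]
      exact hB
    · have h1 := insert_sdiff_insert_sdiff_cancel hA.2.2 (src ω hω hA).1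
      have h2 := insert_sdiff_insert_sdiff_cancel hA'.2.2 (src ω' hω' hA').1
      rw [← h1, ← h2, h]
  -- step (ii): the detour lemma on `(M'', u'')`
  have step2 := hD M'' u'' hd'' o v w
  -- step (iii): move back
  have step3 : fibreCount M'' u'' (forestEv V ∩ {ω | s(o, v) ∈ ω} ∩ (reachEv o w)ᶜ) (forestEv V ∩ reachEv o v) ≤
      fibreCount M u₀ (forestEv V ∩ {ω | s(o, v) ∈ ω ∧ s(o, y) ∈ ω} ∩ (reachEv o w)ᶜ) (forestEv V ∩ reachEv o v) := by
    -- facts about a target colouring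
    have tgt : ∀ ω' : BondConfig V, ω' \ M'' = u'' → ω' ∈ forestEv V ∩ {ω | s(o, v) ∈ ω} ∩ (reachEv o w)ᶜ →
        s(v, y) ∈ ω' ∧ s(o, y) ∉ ω' ∧ IsForestCfg (insert s(o, y) (ω' \ {s(v, y)})) ∧
          ¬ (openGraph (insert s(o, y) (ω' \ {s(v, y)}))).Reachable o w := by
      rintro ω' hω' ⟨⟨hF, he⟩, how⟩
      have ht : s(v, y) ∈ ω' := subset_of_fibre hω' (mem_insert _ _)
      have hf : s(o, y) ∉ ω' := fun h' => by
        rcases mem_union_of_fibre hω' h' with h'' | h''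
        · exact h''.2 (Or.inl rfl)
        · rcases mem_insert_iff.1 h'' with h'' | h''
          · exact hft h''
          · exact hfu h''
      have hf' : s(o, y) ∉ ω' \ {s(v, y)} := fun h' => hf h'.1
      have ht' : s(v, y) ∉ ω' \ {s(v, y)} := fun h' => h'.2 rfl
      have hback : insert s(v, y) (ω' \ {s(v, y)}) = ω' := by rw [insert_sdiff_singleton, insert_eq_of_mem ht]
      have hsplit := (isForestCfg_insert_iff hvy ht').1 (hback.symm ▸ hF)
      have he' : s(o, v) ∈ ω' \ {s(v, y)} := ⟨he, fun h' => het h'⟩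
      have hov' : (openGraph (ω' \ {s(v, y)})).Reachable o v := ((openGraph_adj _ _ _).2 ⟨he', hov⟩).reachable
      refine ⟨ht, hf, (isForestCfg_insert_iff hoy hf').2 ⟨hsplit.1, fun h' => hsplit.2 (hov'.symm.trans h')⟩, fun h' => how ?_⟩
      -- `o ~ w` in `(ω' ∖ t) ∪ f` gives `o ~ w` in `ω'` since `o ~ y` in `ω'` (via `e, t`)
      have hoy' : (openGraph ω').Reachable o y :=
        (((openGraph_adj _ _ _).2 ⟨he, hov⟩).reachable).trans ((openGraph_adj _ _ _).2 ⟨ht, hvy⟩).reachable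
      exact reachable_of_reachable_insert_of_subset sdiff_subset hoy' h'
    refine fibreCount_le_of_injOn (fun ω' => insert s(o, y) (ω' \ {s(v, y)})) (fun ω' hω' hA hB => ?_)
      (fun ω ω' hω hA hB hω' hA' hB' h => ?_)
    · obtain ⟨ht, hf, hF', how'⟩ := tgt ω' hω' hA
      have hfib : insert s(o, y) (ω' \ {s(v, y)}) \ M = u₀ := insert_sdiff_sdiff_of_pair hω' hfM hf htu hft
      refine ⟨hfib, ⟨⟨hF', mem_insert_of_mem _ ⟨hA.1.2, het⟩, mem_insert _ _⟩, how'⟩, ?_⟩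
      -- the partner is unchanged
      have ht2 : s(v, y) ∉ insert s(o, y) (ω' \ {s(v, y)}) := fun h' => by
        rcases mem_insert_iff.1 h' with h'' | h''
        · exact hft h''.symm
        · exact h''.2 rfl
      have key := insert_sdiff_symmDiff_sdiff_pair (ω := insert s(o, y) (ω' \ {s(v, y)})) hfM htM (mem_insert _ _) ht2
      rw [insert_sdiff_insert_sdiff_cancel ht hf] at key
      rw [← key]
      exact hB
    · have h1 := insert_sdiff_insert_sdiff_cancel (tgt ω hω hA).1 (tgt ω hω hA).2.1
      have h2 := insert_sdiff_insert_sdiff_cancel (tgt ω' hω' hA').1 (tgt ω' hω' hA').2.1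
      rw [← h1, ← h2, h]
  exact step1.trans (step2.trans step3)

end Transfer


end FK
end Summit.CriticalPhenomena.PercolationContinuityZ3.Theorems

end
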